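/-
Copyright: statement-level skeleton of a published paper (lit-balaban cell, Phase-2 proof seat p13, gen 6). No proof
claims beyond what the kernel checks below.
-/
import Literature.MathematicalPhysics.QuantumFieldTheory.BalabanImbrieJaffe1984to88.BIJ88TruncatedPair306

/-!
# `BalabanImbrieJaffe1984to88.BIJ88FirstTerm5133` — T. Bałaban, J. Imbrie, A. Jaffe, *Effective action and cluster
properties of the abelian Higgs model*, Commun. Math. Phys. **114** (1988) 257–315 [BalabanImbrieJaffe1988], §5.13
p. 305–306 [PDF 49–50], the ONE-PAIR TERM of the cluster expansion **(5.13.3)**: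
**"∂/∂s_Γ⟨Πf(□_i)⟩_{s_Γ} = … Σ_{ω} ⟨δ/δΦ, C_s□_{i₁}Δ□_{i₂}C_s(½ δ/δΦ + ℱ)⟩ … The 1/2 for the δ²/δΦ² term compensates
for the fact that we count a walk as being different from its reverse."** — PROVED for `|Γ| = 1` (one derivative
`∂/∂s_i`, walks of one step `(i, j)`): assembling `…BIJ88SDerivative305` (the derivative is minus the truncated
expectation of `D_i = Σ_{j≠i}s_j⟨□_iΦ,Δ□_jΦ⟩`) with `…BIJ88TruncatedPair306` (the truncated pair = the δ/δΦ-trains),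
`∂/∂s_i ⟨H⟩_s = −(1/Z)·Σ_{x,y} (M_i)_{xy}·[⟨C e_y,ℱ⟩∫∂_{Ce_x}H dμ + ⟨Ce_x,ℱ⟩∫∂_{Ce_y}H dμ + ∫∂_{Ce_y}∂_{Ce_x}H dμ]`,
`M_i = Σ_{j≠i} s_j □_iΔ□_j` — in operator language `−[⟨C_sℱ, M_iᵀC_s δ/δΦ⟩ + ⟨C_sℱ, M_iC_s δ/δΦ⟩ + ⟨C_sδ/δΦ, M_i C_s δ/δΦ⟩]H`,
both orientations of the one-step walk appearing (the printed `½`).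

statement-level skeleton of published theorems with citation tags; proofs where landed; nothing here is a claim
about the Yang–Mills mass gap

PDF held: `paper:balaban1988-cmp114-bij-abelian-higgs-effective-action` (journal page = PDF page + 256; p. 305–306
read with `lit read … --pages 49-50`).

CITATION HEADER (lean-in-tree rule).  lit-balaban cell (HOME `run/shared/lean/pub/lit-balaban/`), Phase 2, seat p13
gen 6 (unit `lit-balaban-p13-g6`); eighth file of the p. 305–306 group; row **C2.Eq5.13.3-5.13.4** of
`HOME/lit-balaban-r16/ROWS-C2-part2.md` (owner r16, referee ref-5): the display (5.13.3) restricted to its first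
(one-pair) term.  USED BY NAME, nothing restated: `…BIJ88SDerivative305.hasDerivAt_expectation_interp`,
`integral_weight_mul_source_pos`, `update_mem_cube` (p256629); `…BIJ88TruncatedPair306.pair_truncated` (p257103);
`…BIJ88IntegrationByParts305.integrable_fieldProd_bdd_tilt`, `weight_mul_source` (p256140);
`…BIJ88DirichletDeriv305.quadForm_boxSandwich`, `blockPair` (p02, p253961); `…BIJ88DirichletForms305.interpForm`,
`boxProj`, `interpForm_posDef` (p02, p252603); `…Balaban1983to89.B2Eq228Conditioning` (`weight`, `source`).

## What is proved (0 `sorry`, standard axioms, theorems only, no new `def`)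

* §1 `quadForm_eq_sum`: `⟨Φ,MΦ⟩ = Σ_{x,y} M_{xy} Φ(e_x)Φ(e_y)`; `D_eq_quadForm`: the pulled-down term is a quadratic form,
  `Σ_{j≠i}s_j⟨□_iΦ,Δ□_jΦ⟩ = ⟨Φ, M_iΦ⟩`, `M_i = Σ_{j≠i} s_j □_iΔ□_j`.
* §2 `integral_quadForm_mul`: `∫⟨Φ,MΦ⟩H dμ = Σ_{x,y}M_{xy}∫Φ(e_x)Φ(e_y)H dμ` (bounded measurable `H`);
  **`quadForm_truncated`**: `Z∫⟨Φ,MΦ⟩H dμ − (∫⟨Φ,MΦ⟩dμ)(∫H dμ) = Z·Σ_{x,y}M_{xy}[⟨Ce_y,ℱ⟩∫∂_{Ce_x}H + ⟨Ce_x,ℱ⟩∫∂_{Ce_y}H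
  + ∫∂_{Ce_y}∂_{Ce_x}H]` (`H ∈ C²_b`) — only δ/δΦ-trains survive the truncation of a quadratic insertion.
* §3 **`hasDerivAt_expectation_firstTerm`** — THE ONE-PAIR TERM OF (5.13.3): for `Δ` positive definite with form
  bounds `c‖v‖² ≤ ⟨v,Δv⟩ ≤ C‖v‖²`, `s ∈ [0,1]^I`, `t₀ ∈ [0,1]`, `H ∈ C²_b`, precision `A = Δ_{s[i↦t₀]}`, `C = A⁻¹`,
  `dμ = e^{−½⟨Φ,AΦ⟩}e^{⟨ℱ,Φ⟩}dΦ`, `Z = ∫dμ`: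
  `d/dt|_{t₀} (∫H dμ_t/∫dμ_t) = −(Σ_{x,y}(M_i)_{xy}[⟨Ce_y,ℱ⟩∫∂_{Ce_x}H dμ + ⟨Ce_x,ℱ⟩∫∂_{Ce_y}H dμ + ∫∂_{Ce_y}∂_{Ce_x}H dμ])/Z`.
* §4 `sum_trains_symm`: for symmetric `M` the three trains regroup as `2·Σ M_{xy}[a_x b_y + ½c_{xy}]` — the
  printed *"1/2 for the δ²/δΦ² term … we count a walk as being different from its reverse"*.
HONEST SCOPE.  One parameter / one pair (the general term of (5.13.3) iterates derivatives and contractions into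
walks `ω` and partitions `π` — NOT modelled); `H ∈ C²_b` (characteristic functions as smooth cutoffs); printed sign
convention `Δ_print = −Δ`.  NOT summit progress; NOT continuum; NOT Clay.  Imports `BIJ88TruncatedPair306`; modifies
nothing.
-/

namespace Literature.MathematicalPhysics.QuantumFieldTheory.BalabanImbrieJaffe1984to88.BIJ88FirstTerm5133

open MeasureTheory Matrix Finset Filter Function
open scoped BigOperators
open Literature.MathematicalPhysics.QuantumFieldTheory.Balaban1983to89
open B2Eq228Conditioning (weight source)
open BIJ88DirichletForms305 (interpForm boxProj interpForm_posDef)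
open BIJ88DirichletDeriv305 (blockPair quadForm_boxSandwich)
open BIJ88IntegrationByParts305 (weight_mul_source integrable_fieldProd_bdd_tilt)
open BIJ88SDerivative305 (hasDerivAt_expectation_interp integral_weight_mul_source_pos update_mem_cube)
open BIJ88TruncatedPair306 (pair_truncated)

/-! ## §1  Quadratic insertions as double sums over coordinate fields -/

section QuadForm

variable {S : Type} [Fintype S] [DecidableEq S]

/-- `⟨Φ, MΦ⟩ = Σ_{x,y} M_{xy} Φ(e_x)Φ(e_y)` — a quadratic insertion is a sum of pairs of fields.
[cite: BalabanImbrieJaffe1988, (5.13.3) p.306] -/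
theorem quadForm_eq_sum (M : Matrix S S ℝ) (φ : S → ℝ) :
    φ ⬝ᵥ (M *ᵥ φ) = ∑ x, ∑ y, M x y * ((φ ⬝ᵥ Pi.single x 1) * (φ ⬝ᵥ Pi.single y 1)) := by
  simp only [dotProduct_single_one]
  simp only [dotProduct, mulVec, Finset.mul_sum]
  exact Finset.sum_congr rfl fun x _ => Finset.sum_congr rfl fun y _ => by ring

/-- `∫⟨Φ,MΦ⟩H dμ = Σ_{x,y} M_{xy} ∫Φ(e_x)Φ(e_y)H dμ` for bounded measurable `H` (`dμ = e^{−½⟨Φ,AΦ⟩}e^{⟨ℱ,Φ⟩}dΦ`, `A`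
positive definite). [cite: BalabanImbrieJaffe1988, (5.13.3) p.306] -/
theorem integral_quadForm_mul (A : Matrix S S ℝ) (hA : A.PosDef) (f : S → ℝ) (M : Matrix S S ℝ)
    {H : (S → ℝ) → ℝ} (hHm : AEStronglyMeasurable H volume) {K₀ : ℝ} (hK : ∀ φ, ‖H φ‖ ≤ K₀) :
    ∫ φ : S → ℝ, (φ ⬝ᵥ (M *ᵥ φ)) * H φ * (weight A φ * source f φ)
      = ∑ x, ∑ y, M x y *
          ∫ φ : S → ℝ, (φ ⬝ᵥ Pi.single x 1) * (φ ⬝ᵥ Pi.single y 1) * H φ * (weight A φ * source f φ) := by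
  have hI : ∀ x y : S, Integrable fun φ : S → ℝ =>
      (φ ⬝ᵥ Pi.single x 1) * (φ ⬝ᵥ Pi.single y 1) * H φ * (weight A φ * source f φ) := by
    intro x y
    have h := integrable_fieldProd_bdd_tilt hA (Finset.univ : Finset (Fin 2))
      (![Pi.single x (1:ℝ), Pi.single y (1:ℝ)]) f hHm hK
    refine h.congr (Eventually.of_forall fun φ => ?_)
    simp only [Fin.prod_univ_two, Matrix.cons_val_zero, Matrix.cons_val_one, weight_mul_source]
  have hI' : ∀ x y : S, Integrable fun φ : S → ℝ =>
      M x y * ((φ ⬝ᵥ Pi.single x 1) * (φ ⬝ᵥ Pi.single y 1) * H φ * (weight A φ * source f φ)) :=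
    fun x y => (hI x y).const_mul _
  calc ∫ φ : S → ℝ, (φ ⬝ᵥ (M *ᵥ φ)) * H φ * (weight A φ * source f φ)
      = ∫ φ : S → ℝ, ∑ x, ∑ y, M x y *
          ((φ ⬝ᵥ Pi.single x 1) * (φ ⬝ᵥ Pi.single y 1) * H φ * (weight A φ * source f φ)) := by
        congr 1
        funext φ
        rw [quadForm_eq_sum, Finset.sum_mul, Finset.sum_mul]
        refine Finset.sum_congr rfl fun x _ => ?_
        rw [Finset.sum_mul, Finset.sum_mul]
        exact Finset.sum_congr rfl fun y _ => by ring
    _ = ∑ x, ∫ φ : S → ℝ, ∑ y, M x y *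
          ((φ ⬝ᵥ Pi.single x 1) * (φ ⬝ᵥ Pi.single y 1) * H φ * (weight A φ * source f φ)) :=
        integral_finsetSum _ fun x _ => integrable_finsetSum _ fun y _ => hI' x y
    _ = ∑ x, ∑ y, ∫ φ : S → ℝ, M x y *
          ((φ ⬝ᵥ Pi.single x 1) * (φ ⬝ᵥ Pi.single y 1) * H φ * (weight A φ * source f φ)) :=
        Finset.sum_congr rfl fun x _ => integral_finsetSum _ fun y _ => hI' x y
    _ = _ := Finset.sum_congr rfl fun x _ => Finset.sum_congr rfl fun y _ => integral_const_mul _ _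

/-- **TRUNCATION OF A QUADRATIC INSERTION** (`H ∈ C²` with `H, DH, D²H` bounded; `C = A⁻¹`, `Z = ∫dμ`):
`Z∫⟨Φ,MΦ⟩H dμ − (∫⟨Φ,MΦ⟩dμ)(∫H dμ) = Z·Σ_{x,y} M_{xy}[⟨Ce_y,ℱ⟩∫∂_{Ce_x}H dμ + ⟨Ce_x,ℱ⟩∫∂_{Ce_y}H dμ + ∫∂_{Ce_y}∂_{Ce_x}H dμ]`
— by `BIJ88TruncatedPair306.pair_truncated` pair by pair: closed loops and ℱ–ℱ trains have disappeared.
[cite: BalabanImbrieJaffe1988, (5.13.3) p.306] -/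
theorem quadForm_truncated (A : Matrix S S ℝ) (hA : A.PosDef) (f : S → ℝ) (M : Matrix S S ℝ)
    {H : (S → ℝ) → ℝ} (hH : ContDiff ℝ 2 H) {K₀ K₁ K₂ : ℝ} (h0 : ∀ φ, ‖H φ‖ ≤ K₀)
    (h1 : ∀ φ, ‖fderiv ℝ H φ‖ ≤ K₁) (h2 : ∀ φ, ‖fderiv ℝ (fderiv ℝ H) φ‖ ≤ K₂) :
    (∫ φ : S → ℝ, weight A φ * source f φ)
        * (∫ φ : S → ℝ, (φ ⬝ᵥ (M *ᵥ φ)) * H φ * (weight A φ * source f φ))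
      - (∫ φ : S → ℝ, (φ ⬝ᵥ (M *ᵥ φ)) * (weight A φ * source f φ))
        * (∫ φ : S → ℝ, H φ * (weight A φ * source f φ))
      = (∫ φ : S → ℝ, weight A φ * source f φ) * ∑ x, ∑ y, M x y *
          (((A⁻¹ *ᵥ Pi.single y 1) ⬝ᵥ f)
              * (∫ φ : S → ℝ, fderiv ℝ H φ (A⁻¹ *ᵥ Pi.single x 1) * (weight A φ * source f φ))
            + ((A⁻¹ *ᵥ Pi.single x 1) ⬝ᵥ f)
              * (∫ φ : S → ℝ, fderiv ℝ H φ (A⁻¹ *ᵥ Pi.single y 1) * (weight A φ * source f φ))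
            + ∫ φ : S → ℝ, fderiv ℝ (fun ψ : S → ℝ => fderiv ℝ H ψ (A⁻¹ *ᵥ Pi.single x 1)) φ
                (A⁻¹ *ᵥ Pi.single y 1) * (weight A φ * source f φ)) := by
  have hHm : AEStronglyMeasurable H volume := hH.continuous.aestronglyMeasurable
  have hV : ∫ φ : S → ℝ, (φ ⬝ᵥ (M *ᵥ φ)) * (weight A φ * source f φ)
      = ∑ x, ∑ y, M x y *
          ∫ φ : S → ℝ, (φ ⬝ᵥ Pi.single x 1) * (φ ⬝ᵥ Pi.single y 1) * (weight A φ * source f φ) := by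
    have h := integral_quadForm_mul A hA f M (H := fun _ => (1:ℝ)) aestronglyMeasurable_const (K₀ := 1)
      (fun _ => norm_one.le)
    simp only [mul_one] at h
    exact h
  rw [integral_quadForm_mul A hA f M hHm h0, hV]
  simp only [Finset.mul_sum, Finset.sum_mul, ← Finset.sum_sub_distrib]
  refine Finset.sum_congr rfl fun x _ => Finset.sum_congr rfl fun y _ => ?_
  have h := pair_truncated A hA f hH h0 h1 h2 (Pi.single x 1) (Pi.single y 1)
  linear_combination (M x y) * h

end QuadForm

/-! ## §2  The pulled-down term `D_i` is a quadratic insertion -/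

section Blocks

variable {α I : Type} [Fintype α] [DecidableEq α] [Fintype I] [DecidableEq I] (blk : α → I)

/-- `D_i(Φ) = Σ_{j≠i} s_j⟨□_iΦ, Δ□_jΦ⟩ = ⟨Φ, M_iΦ⟩` with `M_i = Σ_{j≠i} s_j □_iΔ□_j` (p02's `quadForm_boxSandwich`).
[cite: BalabanImbrieJaffe1988, (5.13.3) p.305] -/
theorem D_eq_quadForm (Δ : Matrix α α ℝ) (s : I → ℝ) (i : I) (φ : α → ℝ) :
    ∑ j ∈ univ.erase i, s j * blockPair blk Δ φ i j
      = φ ⬝ᵥ ((∑ j ∈ univ.erase i, s j • (boxProj blk i * Δ * boxProj blk j)) *ᵥ φ) := by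
  rw [Matrix.sum_mulVec, dotProduct_sum]
  refine Finset.sum_congr rfl fun j _ => ?_
  rw [Matrix.smul_mulVec, dotProduct_smul, smul_eq_mul, quadForm_boxSandwich]

/-! ## §3  The one-pair term of (5.13.3) -/

/-- **THE ONE-PAIR TERM OF THE CLUSTER EXPANSION (5.13.3)** — *"∂/∂s_Γ⟨Πf(□_i)⟩_{s_Γ} = … ⟨δ/δΦ,
C_s□_{i₁}Δ□_{i₂}C_s(½δ/δΦ + ℱ)⟩ … The 1/2 for the δ²/δΦ² term compensates for the fact that we count a walk as being
different from its reverse"*, for one derivative: `Δ` positive definite with form bounds `c‖v‖² ≤ ⟨v,Δv⟩ ≤ C‖v‖²`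
(`c > 0`), `s ∈ [0,1]^I`, `t₀ ∈ [0,1]`, `H ∈ C²` with `H, DH, D²H` bounded; `A = Δ_{s[i↦t₀]}`, `C = A⁻¹`,
`dμ = e^{−½⟨Φ,AΦ⟩}e^{⟨ℱ,Φ⟩}dΦ`, `Z = ∫dμ`, `M_i = Σ_{j≠i}s_j□_iΔ□_j`.  Then
`d/dt|_{t₀}(∫H dμ_t / ∫dμ_t) = −(Σ_{x,y}(M_i)_{xy}[⟨Ce_y,ℱ⟩∫∂_{Ce_x}H dμ + ⟨Ce_x,ℱ⟩∫∂_{Ce_y}H dμ + ∫∂_{Ce_y}∂_{Ce_x}H dμ]) / Z`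
— minus the sum over the one-step walks `x → y` AND `y → x` of the trains `ℱ–C–M_i–C–δ/δΦ` and `δ/δΦ–C–M_i–C–δ/δΦ`
applied to `H`. [cite: BalabanImbrieJaffe1988, (5.13.3) p.305–306] -/
theorem hasDerivAt_expectation_firstTerm {Δ : Matrix α α ℝ} (hΔ : Δ.PosDef) {c C : ℝ} (hc : 0 < c)
    (hcΔ : ∀ v, c * (v ⬝ᵥ v) ≤ v ⬝ᵥ (Δ *ᵥ v)) (hCΔ : ∀ v, v ⬝ᵥ (Δ *ᵥ v) ≤ C * (v ⬝ᵥ v))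
    {s : I → ℝ} (hs : ∀ j, 0 ≤ s j ∧ s j ≤ 1) (i : I) {t₀ : ℝ} (ht₀ : 0 ≤ t₀ ∧ t₀ ≤ 1) (f : α → ℝ)
    {H : (α → ℝ) → ℝ} (hH : ContDiff ℝ 2 H) {K₀ K₁ K₂ : ℝ} (h0 : ∀ φ, ‖H φ‖ ≤ K₀)
    (h1 : ∀ φ, ‖fderiv ℝ H φ‖ ≤ K₁) (h2 : ∀ φ, ‖fderiv ℝ (fderiv ℝ H) φ‖ ≤ K₂) :
    HasDerivAt
      (fun u => (∫ φ : α → ℝ, H φ * (weight (interpForm blk Δ (update s i u)) φ * source f φ))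
        / ∫ φ : α → ℝ, weight (interpForm blk Δ (update s i u)) φ * source f φ)
      (-((∑ x, ∑ y, (∑ j ∈ univ.erase i, s j • (boxProj blk i * Δ * boxProj blk j) : Matrix α α ℝ) x y *
          ((((interpForm blk Δ (update s i t₀))⁻¹ *ᵥ Pi.single y 1) ⬝ᵥ f)
              * (∫ φ : α → ℝ, fderiv ℝ H φ ((interpForm blk Δ (update s i t₀))⁻¹ *ᵥ Pi.single x 1)
                  * (weight (interpForm blk Δ (update s i t₀)) φ * source f φ))
            + (((interpForm blk Δ (update s i t₀))⁻¹ *ᵥ Pi.single x 1) ⬝ᵥ f)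
              * (∫ φ : α → ℝ, fderiv ℝ H φ ((interpForm blk Δ (update s i t₀))⁻¹ *ᵥ Pi.single y 1)
                  * (weight (interpForm blk Δ (update s i t₀)) φ * source f φ))
            + ∫ φ : α → ℝ,
                fderiv ℝ (fun ψ : α → ℝ => fderiv ℝ H ψ ((interpForm blk Δ (update s i t₀))⁻¹ *ᵥ Pi.single x 1)) φ
                  ((interpForm blk Δ (update s i t₀))⁻¹ *ᵥ Pi.single y 1)
                * (weight (interpForm blk Δ (update s i t₀)) φ * source f φ)))
        / ∫ φ : α → ℝ, weight (interpForm blk Δ (update s i t₀)) φ * source f φ)) t₀ := by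
  have hA : (interpForm blk Δ (update s i t₀)).PosDef := interpForm_posDef blk hΔ (update_mem_cube hs i ht₀)
  have hZ : (∫ φ : α → ℝ, weight (interpForm blk Δ (update s i t₀)) φ * source f φ) ≠ 0 :=
    (integral_weight_mul_source_pos hA f).ne'
  have hD := hasDerivAt_expectation_interp blk hΔ hc hcΔ hCΔ hs i ht₀ f (G := H)
    hH.continuous.aestronglyMeasurable h0
  refine hD.congr_deriv ?_
  -- the pulled-down term as a quadratic insertion
  have hDq : ∀ φ : α → ℝ, (∑ j ∈ univ.erase i, s j * blockPair blk Δ φ i j) * H φ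
      = (φ ⬝ᵥ ((∑ j ∈ univ.erase i, s j • (boxProj blk i * Δ * boxProj blk j)) *ᵥ φ)) * H φ := fun φ => by
    rw [D_eq_quadForm]
  have hDq' : ∀ φ : α → ℝ, (∑ j ∈ univ.erase i, s j * blockPair blk Δ φ i j)
      * (weight (interpForm blk Δ (update s i t₀)) φ * source f φ)
      = (φ ⬝ᵥ ((∑ j ∈ univ.erase i, s j • (boxProj blk i * Δ * boxProj blk j)) *ᵥ φ))
      * (weight (interpForm blk Δ (update s i t₀)) φ * source f φ) := fun φ => by
    rw [D_eq_quadForm]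
  simp_rw [hDq, hDq']
  have hq := quadForm_truncated (interpForm blk Δ (update s i t₀)) hA f
    (∑ j ∈ univ.erase i, s j • (boxProj blk i * Δ * boxProj blk j)) hH h0 h1 h2
  -- clear denominators: `a/Z − (b/Z)(c/Z) = S/Z ⇐ Z·a − b·c = Z·S` (= `hq`)
  rw [neg_inj, div_mul_div_comm, div_sub_div _ _ hZ (mul_ne_zero hZ hZ),
    div_eq_div_iff (mul_ne_zero hZ (mul_ne_zero hZ hZ)) hZ]
  linear_combination ((∫ φ : α → ℝ, weight (interpForm blk Δ (update s i t₀)) φ * source f φ)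
    * ∫ φ : α → ℝ, weight (interpForm blk Δ (update s i t₀)) φ * source f φ) * hq

end Blocks

/-! ## §4  "The 1/2 for the δ²/δΦ² term compensates for the fact that we count a walk as being different
from its reverse" -/

section Half

variable {S : Type} [Fintype S]

/-- **The printed `½`**: for a SYMMETRIC insertion matrix `M` (as `□_{i₁}Δ□_{i₂} + □_{i₂}Δ□_{i₁}`, both orientations
of the one-step walk), the three surviving trains regroup as
`Σ_{x,y} M_{xy}[a_y b_x + a_x b_y + c_{xy}] = 2·Σ_{x,y} M_{xy}[a_x b_y + ½ c_{xy}]` — with `a_x = ⟨Ce_x,ℱ⟩`,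
`b_y = ∫∂_{Ce_y}H dμ`, `c_{xy} = ∫∂_{Ce_y}∂_{Ce_x}H dμ` this is `2·⟨δ/δΦ, C M C(½ δ/δΦ + ℱ)⟩H` in the printed
operator language: the ℱ-ended train counted once per orientation, the `δ²/δΦ²` train carrying the `½`.
[cite: BalabanImbrieJaffe1988, (5.13.3) p.306] -/
theorem sum_trains_symm (M : Matrix S S ℝ) (hM : M.IsSymm) (a b : S → ℝ) (c : S → S → ℝ) :
    ∑ x, ∑ y, M x y * (a y * b x + a x * b y + c x y)
      = 2 * ∑ x, ∑ y, M x y * (a x * b y + (1 / 2 : ℝ) * c x y) := by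
  have hswap : ∑ x, ∑ y, M x y * (a y * b x) = ∑ x, ∑ y, M x y * (a x * b y) := by
    rw [Finset.sum_comm]
    exact Finset.sum_congr rfl fun x _ => Finset.sum_congr rfl fun y _ => by rw [hM.apply y x]
  have hsplit : ∑ x, ∑ y, M x y * (a y * b x + a x * b y + c x y)
      = (∑ x, ∑ y, M x y * (a y * b x)) + ∑ x, ∑ y, M x y * (a x * b y + c x y) := by
    rw [← Finset.sum_add_distrib]
    refine Finset.sum_congr rfl fun x _ => ?_
    rw [← Finset.sum_add_distrib]
    exact Finset.sum_congr rfl fun y _ => by ring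
  rw [hsplit, hswap, ← Finset.sum_add_distrib, Finset.mul_sum]
  refine Finset.sum_congr rfl fun x _ => ?_
  rw [← Finset.sum_add_distrib, Finset.mul_sum]
  exact Finset.sum_congr rfl fun y _ => by ring

end Half

end Literature.MathematicalPhysics.QuantumFieldTheory.BalabanImbrieJaffe1984to88.BIJ88FirstTerm5133
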